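import Literature.NumberTheory.LFunctions.NicolasK
import Literature.NumberTheory.LFunctions.NicolasJExplicit
import Literature.NumberTheory.LFunctions.NicolasPsiTheta
import Literature.NumberTheory.LFunctions.RobinAnalyticSharp
import Literature.NumberTheory.LFunctions.LagariasCriterionAssembly
import HarnessLib

/-!
# Nicolas 2012, (2.18) assembled: `Nicolas2012_logf_lower_sharp` from Schoenfeld's `θ`-bound and
# the two computational inputs of Lemma 2.4; Robin's and Lagarias's criteria re-based

Topic: `Literature/NumberTheory/LFunctions`. Pure proof file (no definition, nothing asserted):
the assembly step of the provefact `Literature.NumberTheory.LFunctions.lagarias_iff` that ELIMINATES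
the deepest analytic named fact on its path, Nicolas's RH-explicit Mertens bound (2.18)
(`Literature.NumberTheory.LFunctions.Nicolas2012_logf_lower_sharp`, `NicolasMertensRH.lean`), in
favour of its printed inputs:

* `Nicolas2012Sharp.Nicolas2012_logf_lower_sharp_of (hS : Schoenfeld1976_theta)
  (hPT : PlattTrudgian2016_theta_lt) (hC1 : Nicolas2012_lemma24_case1) : Nicolas2012_logf_lower_sharp`
  — Nicolas's own derivation of (2.18), "collecting the information from (2.1), (1.12), (2.13),
  (2.14), (2.15), (2.4) and (2.5)": Lemma 2.1 (`NicolasK.lemma21_lower`, with `θ ≥ 4x/5` from (1.12)),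
  (1.12) = `Schoenfeld1976_theta` (the term `log³x/(64π²x)`), Cor. 2.1 (`NicolasK.cor21_upper`, fed
  by Lemma 2.4 (2.12) = `NicolasPsiTheta.Nicolas2012_lemma24_upper`, whose inputs are Schoenfeld's bound and the two
  finite computations `PlattTrudgian2016_theta_lt` (θ(y) < y, y ≤ 1.39·10¹⁷) and
  `Nicolas2012_lemma24_case1` (x < 2³²)), Lemma 2.5 (`NicolasJExplicit.nicolasJ_ge_of_RH`, the
  explicit formula, with `|W| ≤ β`), and (2.4)–(2.5) (`NicolasFz.Fhalf_le`, `NicolasFz.Fthird_le`).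
  Everything analytic is PROVED in the tree (explicit formula for `ψ₁` with its trivial zeros,
  `∑_ρ 1/(ρ(1−ρ)) = β`, Mertens' theorems with constants, Landau–Nicolas oscillation); what enters
  as hypotheses are Schoenfeld's `θ`-bound under RH and published finite computations.
* Consequences for the two criteria (`RHClassicalEquivalents.lean`):
  `lagarias_iff_of_schoenfeld_numeric (hS) (hPT) (hC1) (hnum : RH → robinCA_below (4^11))`,
  `lagarias_iff_of_schoenfeld_briggs (hS) (hPT) (hC1) (hB : Briggs2006_robinInequality_le)`,
  `robin_iff_of_schoenfeld_numeric (hS) (hPT) (hC1) (hnum : robinCA_below (4^11))` — Lagarias's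
  Thm. 1.1 and Robin's criterion resting on Schoenfeld 1976 (6.3) and finite computations only
  (`robinCA_below (4^11)` is being replayed in the kernel by the `ChainRun*` files).

## References

* J.-L. Nicolas, *Small values of the Euler function and the Riemann hypothesis*, Acta Arith. 155
  (2012), 311–321 (arXiv:1202.0729): (1.12), (1.14), Lemma 2.1 (2.1), Lemma 2.2 (2.4)–(2.5),
  Lemma 2.4 (2.12), Cor. 2.1 (2.13), Lemma 2.5 (2.14)–(2.15), and display (2.18). [Nicolas2012]
* L. Schoenfeld, Math. Comp. 30 (1976), 337–360, §6 (6.3). [Schoenfeld1976]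
* J. C. Lagarias, Amer. Math. Monthly 109 (2002), 534–543, Thm. 1.1. [Lagarias2002]
* G. Robin, J. Math. Pures Appl. 63 (1984), 187–213, Thm. 1. [Robin1984]
-/

noncomputable section

open Filter Set MeasureTheory
open scoped Real Chebyshev

namespace Literature.NumberTheory.LFunctions

namespace Nicolas2012Sharp

open NicolasJ NicolasFz NicolasK NicolasJExplicit

/-- Under RH, Schoenfeld's bound gives `θ(x) ≥ 4x/5` for `x ≥ 599` (indeed `θ(x) ≥ (1 − 0.0666) x`,
`RobinAnalyticSharp.schoenfeldDelta_le`). [cite: Schoenfeld1976, §6 (via Nicolas2012 (1.12))] -/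
theorem theta_ge_four_fifths (hS : Schoenfeld1976_theta) (hRH : RiemannHypothesis) {x : ℝ}
    (hx : 599 ≤ x) : 4 / 5 * x ≤ θ x := by
  have hx0 : 0 < x := by linarith
  have h1 := hS hRH x hx
  have hδ := RobinAnalyticSharp.schoenfeldDelta_le hx
  rw [RobinAnalyticSharp.schoenfeldDelta] at hδ
  have hsx : 0 < √x := Real.sqrt_pos.2 hx0
  have h2 : Real.log x ^ 2 ≤ 0.0666 * (8 * π * √x) := (div_le_iff₀ (by positivity)).1 hδ
  have hkey : √x * Real.log x ^ 2 / (8 * π) ≤ 0.0666 * x := by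
    rw [div_le_iff₀ (by positivity)]
    have hx' : √x * √x = x := Real.mul_self_sqrt hx0.le
    calc √x * Real.log x ^ 2 ≤ √x * (0.0666 * (8 * π * √x)) := mul_le_mul_of_nonneg_left h2 hsx.le
      _ = 0.0666 * (√x * √x) * (8 * π) := by ring
      _ = 0.0666 * x * (8 * π) := by rw [hx']
  have := (abs_le.1 h1).1
  linarith

/-- Under RH, Schoenfeld's bound gives `S(x)²/(x² log x) ≤ log³ x/(64 π² x)` for `x ≥ 599`
(`S = θ(x) − x`). [cite: Nicolas2012, (2.18) (the term from (1.12))] -/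
theorem sq_theta_sub_div_le (hS : Schoenfeld1976_theta) (hRH : RiemannHypothesis) {x : ℝ}
    (hx : 599 ≤ x) : (θ x - x) ^ 2 / (x ^ 2 * Real.log x) ≤ Real.log x ^ 3 / (64 * π ^ 2 * x) := by
  have hx0 : 0 < x := by linarith
  have hlx : 0 < Real.log x := Real.log_pos (by linarith)
  have h1 := abs_le.1 (hS hRH x hx)
  have hsq : (θ x - x) ^ 2 ≤ (√x * Real.log x ^ 2 / (8 * π)) ^ 2 := sq_le_sq' h1.1 h1.2
  have hT : (√x * Real.log x ^ 2 / (8 * π)) ^ 2 = x * Real.log x ^ 4 / (64 * π ^ 2) := by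
    rw [div_pow, mul_pow, Real.sq_sqrt hx0.le]; ring
  rw [hT] at hsq
  calc (θ x - x) ^ 2 / (x ^ 2 * Real.log x) ≤ (x * Real.log x ^ 4 / (64 * π ^ 2)) / (x ^ 2 * Real.log x) :=
        div_le_div_of_nonneg_right hsq (mul_nonneg (sq_nonneg x) hlx.le)
    _ = Real.log x ^ 3 / (64 * π ^ 2 * x) := by
        rw [div_div, div_eq_div_iff (by positivity) (by positivity)]
        ring

/-- **Nicolas 2012, (2.18), from Schoenfeld's `θ`-bound and Lemma 2.4** (the discharge of the
analytic part of `Literature.NumberTheory.LFunctions.Nicolas2012_logf_lower_sharp`): collecting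
Lemma 2.1 (`NicolasK.lemma21_lower`), (1.12) (`Schoenfeld1976_theta`), Cor. 2.1
(`NicolasK.cor21_upper`, fed by Lemma 2.4 = `NicolasPsiTheta.Nicolas2012_lemma24_upper`, whence the two computational
inputs `PlattTrudgian2016_theta_lt`, `Nicolas2012_lemma24_case1`), Lemma 2.5
(`NicolasJExplicit.nicolasJ_ge_of_RH`, with `|W| ≤ β`) and Lemma 2.2 (2.4)–(2.5) (`NicolasFz`).
[cite: Nicolas2012, (2.18) (proof of Prop. 2.1)] -/
theorem Nicolas2012_logf_lower_sharp_of (hS : Schoenfeld1976_theta) (hPT : PlattTrudgian2016_theta_lt)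
    (hC1 : Nicolas2012_lemma24_case1) : Nicolas2012_logf_lower_sharp := by
  intro hRH x hx
  have hx1 : (1 : ℝ) < x := by linarith
  obtain ⟨C, hC⟩ := exists_abs_Rone_le_of_RH hRH
  have hR : ∀ t, x ≤ t → |Rone t| ≤ C * t ^ (3 / 2 : ℝ) := fun t ht ↦ hC t (by linarith)
  have hψθ : ∀ t, x ≤ t → ψ t - θ t ≤ Real.sqrt t + 4 / 3 * t ^ ((1 : ℝ) / 3) :=
    fun t ht ↦ NicolasPsiTheta.Nicolas2012_lemma24_upper hRH hS hPT hC1 (by linarith)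
  have h21 := lemma21_lower (by linarith : (121 : ℝ) ≤ x) (theta_ge_four_fifths hS hRH hx)
  have h213 := cor21_upper hx1 hR hψθ
  have hJ := nicolasJ_ge_of_RH hRH hx1
  have hF2 := Fhalf_le hx1
  have hF3 := Fthird_le hx1
  have hS2 := sq_theta_sub_div_le hS hRH hx
  -- atoms
  obtain ⟨a₁, ha₁⟩ : ∃ a : ℝ, a = 1 / (Real.sqrt x * Real.log x) := ⟨_, rfl⟩
  obtain ⟨a₂, ha₂⟩ : ∃ a : ℝ, a = 1 / (Real.sqrt x * Real.log x ^ 2) := ⟨_, rfl⟩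
  obtain ⟨a₃, ha₃⟩ : ∃ a : ℝ, a = 1 / (Real.sqrt x * Real.log x ^ 3) := ⟨_, rfl⟩
  obtain ⟨a₅, ha₅⟩ : ∃ a : ℝ, a = 1 / (x ^ ((2 : ℝ) / 3) * Real.log x) := ⟨_, rfl⟩
  have eJ : -nicolasBeta / (Real.sqrt x * Real.log x)
      - nicolasBeta * ((1 + 4 / Real.log x) / (Real.sqrt x * Real.log x ^ 2))
      - Real.log (2 * π) / (x * Real.log x) =
      -nicolasBeta * a₁ - nicolasBeta * a₂ - 4 * nicolasBeta * a₃ - Real.log (2 * π) / (x * Real.log x) := by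
    rw [ha₁, ha₂, ha₃]; ring
  have eF2 : 2 / (Real.sqrt x * Real.log x) - 2 / (Real.sqrt x * Real.log x ^ 2) +
      8 / (Real.sqrt x * Real.log x ^ 3) = 2 * a₁ - 2 * a₂ + 8 * a₃ := by
    rw [ha₁, ha₂, ha₃]; ring
  have eF3 : 3 / (2 * x ^ (2 / 3 : ℝ) * Real.log x) = 3 / 2 * a₅ := by
    rw [ha₅]; ring
  have eT : -(nicolasBeta + 2) / (√x * Real.log x) + (2 - nicolasBeta) / (√x * Real.log x ^ 2)
      - (8 + 4 * nicolasBeta) / (√x * Real.log x ^ 3) - Real.log (2 * π) / (x * Real.log x)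
      - 2 / (x ^ ((2 : ℝ) / 3) * Real.log x) - Real.log x ^ 3 / (64 * π ^ 2 * x) =
      -(nicolasBeta + 2) * a₁ + (2 - nicolasBeta) * a₂ - (8 + 4 * nicolasBeta) * a₃
      - Real.log (2 * π) / (x * Real.log x) - 2 * a₅ - Real.log x ^ 3 / (64 * π ^ 2 * x) := by
    rw [ha₁, ha₂, ha₃, ha₅]; ring
  rw [eT]
  rw [eJ] at hJ
  rw [eF2] at hF2
  rw [eF3] at hF3
  linarith

end Nicolas2012Sharp

end Literature.NumberTheory.LFunctions

namespace Literature.NumberTheory.LFunctions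

open Nicolas2012Sharp

/-- **Lagarias's criterion re-based** (Lagarias 2002, Thm. 1.1): from Schoenfeld's `θ`-bound under RH,
the two finite computations behind Nicolas's Lemma 2.4, and Robin's inequality for the colossally
abundant numbers with all prime factors below `4¹¹` (under RH; a finite computation,
`robinCA_below (4^11)`). [cite: Lagarias2002, Thm. 1.1] -/
theorem lagarias_iff_of_schoenfeld_numeric (hS : Schoenfeld1976_theta) (hPT : PlattTrudgian2016_theta_lt)
    (hC1 : Nicolas2012_lemma24_case1) (hnum : RiemannHypothesis → robinCA_below (4 ^ 11)) :
    lagarias_iff :=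
  lagarias_iff_of_Robin1984_sigma_le (Robin1984_sigma_le_of_thm1
    (Robin1984_thm1_of_sharp (Nicolas2012_logf_lower_sharp_of hS hPT hC1) hS hnum))

/-- **Lagarias's criterion re-based, Briggs variant**: the same with Briggs's published computation
(`Briggs2006_robinInequality_le`) in place of the kernel interface. [cite: Lagarias2002, Thm. 1.1] -/
theorem lagarias_iff_of_schoenfeld_briggs (hS : Schoenfeld1976_theta) (hPT : PlattTrudgian2016_theta_lt)
    (hC1 : Nicolas2012_lemma24_case1) (hB : Briggs2006_robinInequality_le) : lagarias_iff :=
  lagarias_iff_of_three_facts_sharp (Nicolas2012_logf_lower_sharp_of hS hPT hC1) hS hB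

/-- **Robin's criterion re-based** (Robin 1984, Thm. 1 and §4 Prop. 1): from Schoenfeld's `θ`-bound,
the two finite computations behind Nicolas's Lemma 2.4, and `robinCA_below (4^11)`; the `Ω`-half is
the proved `Nicolas1983_logf_omega_holds`. [cite: Robin1984, Thm. 1 and §4 Prop. 1] -/
theorem robin_iff_of_schoenfeld_numeric (hS : Schoenfeld1976_theta) (hPT : PlattTrudgian2016_theta_lt)
    (hC1 : Nicolas2012_lemma24_case1) (hnum : robinCA_below (4 ^ 11)) : robin_iff :=
  robin_iff_of_sharp_numeric (Nicolas2012_logf_lower_sharp_of hS hPT hC1) hS hnum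
    Nicolas1983_logf_omega_holds

end Literature.NumberTheory.LFunctions

end
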